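import Summits.NavierStokesRegularity.FunctionalMining.NoGo.ConjectureF
import Summits.NavierStokesRegularity.FunctionalMining.NoGo.MiddleEigenvalueKit
import HarnessLib

/-!
# FunctionalMining/NoGo — the determinant form of the F̄ witness obligation, and pattern bases as
# structural zeros of the K1-Q2 kill-all search

Search for candidate a priori estimates; no regularity claim. No-go seat (pub-nsfunc-nogo, gen 6),
staged for the prove seat (the planner seat cannot file under `FunctionalMining/`).

Context. `StrictlyNegativeMiddleFieldExists` (`NoGo/ConjectureF.lean`) is THEOREM F̄ as a statement:
some smooth divergence-free field on `T³` has middle strain eigenvalue `λ₂(S) < 0` at every point; with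
positive weighted stretching it refutes `MiddleEigenvalueMomentRateBound (2m) C` for every `C`
(`middleEigenvalueMomentRateFails_of_strictlyNegative_middle`). This file records two elementary facts
used by the no-go seat's witness programme (NOGO N11(h), CONJECTURE_F.md):

* `MiddleEigen.middle_neg_of_det_pos` / `det_pos_of_middle_neg` / `det_pos_iff_middle_neg` — for a real
  symmetric trace-free matrix over three indices, `0 < det M ↔ λ₂(M) < 0` (the strict companion of the door
  file's `det_nonneg_iff_middleEigenvalue_nonpos`); hence
  `strictlyNegativeMiddleFieldExists_of_det_pos` — **the F̄ witness obligation in determinant form**: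
  a smooth divergence-free `v` on `T³` with `0 < det S(v)(x)` at every point proves
  `StrictlyNegativeMiddleFieldExists`. This is the form an exact certificate checks (`det S` is a
  trigonometric polynomial with rational coefficients when `v` is one; no eigenvalue is computed), and
  `middleEigenvalueMomentRateFails_of_det_pos` is the kill-all door in the same form.
* `MiddleEigen.patternBase_structural_zero` — the algebraic core of the PATTERN BASES
  `A = (U(y), V(x,z), W(y))` of CONJECTURE_F.md §1 (the `λ₂ ≡ 0` fields from which F̄'s witnesses are
  obtained by perturbation, and to which the direct design searches of NOGO N11(h)(F10) re-converge):
  their strain has the shape `!![0,a,0; a,0,b; 0,b,0]` and their vorticity the shape `(w₁, 0, w₃)`, so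
  `det S = 0` (hence `λ₂ = 0`, `middle_patternStrain_eq_zero`) AND `ωᵀSω = 0` identically. At field
  level (`torusStretchingDensity_eq_zero_of_patternBase`, `weightedStretching_eq_zero_of_patternBase`):
  a `C¹` divergence-free field on `T³` whose first component depends on `x₁` only, whose second is
  independent of `x₁` and whose third depends on `x₁` only (five vanishing partial derivatives) has
  `σ ≡ 0`, so every weighted stretching `2m∫|ω|^{2(m−1)}σ` is `0`: pattern bases satisfy the sign
  hypothesis of the door with equality and can never fire it — the kill-all needs a genuine
  perturbation of them (this generalises the unidirectional shears of `MiddleEigen.shear_structural_zero`,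
  which are the pattern bases with `V = 0`).

All statements are finite-dimensional linear algebra plus `∫ 0 = 0` [folklore / ours, elementary];
nothing is claimed about Navier–Stokes.
-/

noncomputable section

open Finset Matrix MeasureTheory

namespace Summit.NavierStokesRegularity.FunctionalMining

open Literature.Analysis Literature.Analysis.FunctionSpaces Literature.Analysis.FunctionSpaces.Torus
  Literature.Analysis.FluidPDE

namespace MiddleEigen

variable {n : Type*} [Fintype n] [DecidableEq n]

/-- **`0 < det M ⇒ λ₂(M) < 0`** for a real symmetric trace-free matrix over three indices:
`det = λ₁λ₂λ₃` with `λ₁ ≥ λ₂ ≥ λ₃`, `Σλ = 0`; `det > 0` forces `λ₂ ≤ 0` (door file) and `λ₂ ≠ 0`.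
[folklore] -/
theorem middle_neg_of_det_pos (hn : Fintype.card n = 3) (M : Matrix n n ℝ) (hsym : M.IsSymm)
    (htr : M.trace = 0) (h : 0 < M.det) :
    (Matrix.isHermitian_iff_isSymm.mpr hsym).eigenvalues₀ (Fin.cast hn.symm 1) < 0 := by
  have hle : (Matrix.isHermitian_iff_isSymm.mpr hsym).eigenvalues₀ (Fin.cast hn.symm 1) ≤ 0 :=
    (det_nonneg_iff_middleEigenvalue_nonpos hn M hsym htr).mp h.le
  rcases hle.lt_or_eq with hlt | heq
  · exact hlt
  · exfalso
    obtain ⟨hdet, -, -, -, -⟩ := spectral_bookkeeping hn M hsym htr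
    beta_reduce at hdet
    rw [heq, mul_zero, zero_mul] at hdet
    exact absurd hdet h.ne'

/-- **`λ₂(M) < 0 ⇒ 0 < det M`** (converse direction): `λ₃ ≤ λ₂ < 0` and `λ₁ = −λ₂ − λ₃ > 0`. [folklore] -/
theorem det_pos_of_middle_neg (hn : Fintype.card n = 3) (M : Matrix n n ℝ) (hsym : M.IsSymm)
    (htr : M.trace = 0)
    (h : (Matrix.isHermitian_iff_isSymm.mpr hsym).eigenvalues₀ (Fin.cast hn.symm 1) < 0) :
    0 < M.det := by
  obtain ⟨hdet, hsum, -, h10, h21⟩ := spectral_bookkeeping hn M hsym htr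
  beta_reduce at hdet hsum h10 h21
  have h2 : (Matrix.isHermitian_iff_isSymm.mpr hsym).eigenvalues₀ (Fin.cast hn.symm 2) < 0 :=
    lt_of_le_of_lt h21 h
  have h0 : 0 < (Matrix.isHermitian_iff_isSymm.mpr hsym).eigenvalues₀ (Fin.cast hn.symm 0) := by
    linarith
  rw [hdet]
  exact mul_pos_of_neg_of_neg (mul_neg_of_pos_of_neg h0 h) h2

/-- **`0 < det M ↔ λ₂(M) < 0`** for a real symmetric trace-free matrix over three indices — the strict
form of the door file's `det_nonneg_iff_middleEigenvalue_nonpos`. [folklore] -/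
theorem det_pos_iff_middle_neg (hn : Fintype.card n = 3) (M : Matrix n n ℝ) (hsym : M.IsSymm)
    (htr : M.trace = 0) :
    0 < M.det ↔ (Matrix.isHermitian_iff_isSymm.mpr hsym).eigenvalues₀ (Fin.cast hn.symm 1) < 0 :=
  ⟨middle_neg_of_det_pos hn M hsym htr, det_pos_of_middle_neg hn M hsym htr⟩

/-! ### Pattern bases: the algebraic core -/

/-- The strain of a pattern base `A = (U(y), V(x,z), W(y))`: `!![0,a,0; a,0,b; 0,b,0]` with
`a = ½(U′ + V_x)`, `b = ½(V_z + W′)`. [ours; elementary] -/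
def patternStrain (a b : ℝ) : Matrix (Fin 3) (Fin 3) ℝ := !![0, a, 0; a, 0, b; 0, b, 0]

/-- Its vorticity `(W′ − V_z, 0, V_x − U′) = (w₁, 0, w₃)`: no component along `e₁`. [ours; elementary] -/
def patternVorticity (w₁ w₃ : ℝ) : Fin 3 → ℝ := ![w₁, 0, w₃]

/-- **Pattern bases are structural zeros of the K1-Q2 kill-all search**: the pattern strain is symmetric
and trace-free with `det = 0` (so `λ₂ = 0`), and the stretching `ωᵀSω` vanishes identically for every
vorticity of the shape `(w₁, 0, w₃)` — in particular for the base's own. [ours; elementary] -/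
theorem patternBase_structural_zero (a b w₁ w₃ : ℝ) :
    (patternStrain a b).IsSymm ∧ (patternStrain a b).trace = 0 ∧ (patternStrain a b).det = 0 ∧
      dotProduct (patternVorticity w₁ w₃) ((patternStrain a b).mulVec (patternVorticity w₁ w₃)) = 0 := by
  refine ⟨?_, ?_, ?_, ?_⟩
  · ext i j
    fin_cases i <;> fin_cases j <;> simp [patternStrain]
  · simp [Matrix.trace, Matrix.diag, Fin.sum_univ_three, patternStrain]
  · norm_num [patternStrain, Matrix.det_fin_three, Matrix.cons_val_zero, Matrix.cons_val_one,
      Matrix.cons_val_two, Matrix.head_cons, Matrix.tail_cons]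
  · simp [patternStrain, patternVorticity, Matrix.mulVec, dotProduct, Fin.sum_univ_three]

/-- Hence `λ₂ = 0` for every pattern strain: pattern bases sit exactly on the boundary `λ₂ ≡ 0` of the
door's hypothesis class. [ours; elementary] -/
theorem middle_patternStrain_eq_zero (a b : ℝ) :
    (Matrix.isHermitian_iff_isSymm.mpr (patternBase_structural_zero a b 0 0).1).eigenvalues₀
      (Fin.cast (Fintype.card_fin 3).symm 1) = 0 :=
  middle_eq_zero_of_det_eq_zero (Fintype.card_fin 3) _ (patternBase_structural_zero a b 0 0).1
    (patternBase_structural_zero a b 0 0).2.1 (patternBase_structural_zero a b 0 0).2.2.1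

end MiddleEigen

/-! ### The F̄ witness obligation in determinant form -/

variable {d : Type*} [Fintype d] [DecidableEq d]

/-- **F̄ in determinant form.** A smooth divergence-free field on `T³` with `0 < det S(x)` at every
point (`S = ½((∂ⱼv)ᵢ + (∂ᵢv)ⱼ)`) proves `StrictlyNegativeMiddleFieldExists`: `det S > 0 ⇔ λ₂(S) < 0`
pointwise for trace-free symmetric `S`. This is the statement an exact certificate for an explicit
trigonometric-polynomial witness would discharge. Search for candidate a priori estimates; no
regularity claim. [ours; elementary] -/
theorem strictlyNegativeMiddleFieldExists_of_det_pos (hd : Fintype.card d = 3)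
    {v : UnitAddTorus d → EuclideanSpace ℝ d} (hv : Torus.IsSmooth v) (hdiv : Torus.IsDivFree v)
    (hdet : ∀ x, 0 < (Matrix.of fun i j =>
        (Torus.partialDeriv j v x i + Torus.partialDeriv i v x j) / 2).det) :
    StrictlyNegativeMiddleFieldExists (d := d) hd := by
  refine ⟨v, hv, hdiv, fun x hx => ?_⟩
  exact MiddleEigen.middle_neg_of_det_pos hd _ (strainMatrix_isSymm v x)
    (strainMatrix_trace_eq_zero (hv.isContDiff (by simp)) hdiv x) (hdet x)

/-- **Kill-all door, determinant form.** A smooth divergence-free field on `T³` with `0 < det S`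
everywhere and positive weighted stretching `2m∫|ω|^{2(m−1)}σ > 0` refutes
`MiddleEigenvalueMomentRateBound (2m) C` for every `C`. Search for candidate a priori estimates; no
regularity claim. [ours; elementary] -/
theorem middleEigenvalueMomentRateFails_of_det_pos {m : ℕ} (hd : Fintype.card d = 3)
    {v : UnitAddTorus d → EuclideanSpace ℝ d} (hv : Torus.IsSmooth v) (hdiv : Torus.IsDivFree v)
    (hdet : ∀ x, 0 < (Matrix.of fun i j =>
        (Torus.partialDeriv j v x i + Torus.partialDeriv i v x j) / 2).det)
    (hpos : 0 < 2 * m * ∫ x, torusVorticitySqAt v x ^ (m - 1) * torusStretchingDensity v x) :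
    ∀ C : ℝ, ¬ MiddleEigenvalueMomentRateBound (d := d) (2 * m) C :=
  middleEigenvalueMomentRateFails_of_strictlyNegative_middle hd hv hdiv
    (fun x hx => MiddleEigen.middle_neg_of_det_pos hd _ (strainMatrix_isSymm v x)
      (strainMatrix_trace_eq_zero (hv.isContDiff (by simp)) hdiv x) (hdet x)) hpos

/-! ### Pattern bases at field level: `σ ≡ 0`, so no weighted stretching -/

/-- **Pattern bases have zero stretching density.** For a `C¹` divergence-free field on `T³` with, at
the point `x`, `(∂₀v)₀ = (∂₂v)₀ = 0` (first component a function of `x₁`), `(∂₁v)₁ = 0` (second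
component independent of `x₁`) and `(∂₀v)₂ = (∂₂v)₂ = 0` (third component a function of `x₁`):
`σ(x) = ωᵀSω = 0` and `det S(x) = 0`. [ours; elementary] -/
theorem torusStretchingDensity_eq_zero_of_patternBase
    {v : UnitAddTorus (Fin 3) → EuclideanSpace ℝ (Fin 3)} (hv : Torus.IsContDiff 1 v)
    (hdiv : Torus.IsDivFree v) {x : UnitAddTorus (Fin 3)}
    (h00 : Torus.partialDeriv 0 v x 0 = 0) (h20 : Torus.partialDeriv 2 v x 0 = 0)
    (h11 : Torus.partialDeriv 1 v x 1 = 0)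
    (h02 : Torus.partialDeriv 0 v x 2 = 0) (h22 : Torus.partialDeriv 2 v x 2 = 0) :
    torusStretchingDensity v x = 0 ∧
      (Matrix.of fun i j : Fin 3 =>
        (Torus.partialDeriv j v x i + Torus.partialDeriv i v x j) / 2).det = 0 := by
  refine ⟨?_, ?_⟩
  · rw [torusStretchingDensity_fin_three_of_isDivFree hv hdiv x]
    simp only [Fin.sum_univ_three, torusVorticityTensor]
    simp only [show (0 : Fin 3) + 1 = 1 from rfl, show (0 : Fin 3) + 2 = 2 from rfl,
      show (1 : Fin 3) + 1 = 2 from rfl, show (1 : Fin 3) + 2 = 0 from rfl,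
      show (2 : Fin 3) + 1 = 0 from rfl, show (2 : Fin 3) + 2 = 1 from rfl, h00, h20, h11, h02, h22]
    ring
  · simp only [Matrix.det_fin_three, Matrix.of_apply, h00, h20, h11, h02, h22]
    ring

/-- **No pattern-base kill-all certificate.** A `C¹` divergence-free pattern base on `T³` (the five
partial derivatives vanish at every point) has `2m∫|ω|^{2(m−1)}σ = 0` for every `m`: the positivity
hypothesis of `middleEigenvalueMomentRateFails_of_nonpos_middle` fails on the whole class, although its
sign hypothesis `λ₂ ≤ 0` holds there with equality. Search for candidate a priori estimates; no
regularity claim. [ours; elementary] -/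
theorem weightedStretching_eq_zero_of_patternBase (m : ℕ)
    {v : UnitAddTorus (Fin 3) → EuclideanSpace ℝ (Fin 3)} (hv : Torus.IsContDiff 1 v)
    (hdiv : Torus.IsDivFree v)
    (h00 : ∀ x, Torus.partialDeriv 0 v x 0 = 0) (h20 : ∀ x, Torus.partialDeriv 2 v x 0 = 0)
    (h11 : ∀ x, Torus.partialDeriv 1 v x 1 = 0)
    (h02 : ∀ x, Torus.partialDeriv 0 v x 2 = 0) (h22 : ∀ x, Torus.partialDeriv 2 v x 2 = 0) :
    2 * m * ∫ x, torusVorticitySqAt v x ^ (m - 1) * torusStretchingDensity v x = 0 := by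
  have hpt : ∀ x, torusVorticitySqAt v x ^ (m - 1) * torusStretchingDensity v x = 0 := fun x => by
    rw [(torusStretchingDensity_eq_zero_of_patternBase hv hdiv (h00 x) (h20 x) (h11 x) (h02 x)
      (h22 x)).1, mul_zero]
  simp [hpt]

/-- The pattern-base strain is pointwise on the boundary of the door's class: `λ₂(S(x)) = 0`.
[ours; elementary] -/
theorem middle_eq_zero_of_patternBase (hd : Fintype.card (Fin 3) = 3)
    {v : UnitAddTorus (Fin 3) → EuclideanSpace ℝ (Fin 3)} (hv : Torus.IsContDiff 1 v)
    (hdiv : Torus.IsDivFree v) {x : UnitAddTorus (Fin 3)}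
    (h00 : Torus.partialDeriv 0 v x 0 = 0) (h20 : Torus.partialDeriv 2 v x 0 = 0)
    (h11 : Torus.partialDeriv 1 v x 1 = 0)
    (h02 : Torus.partialDeriv 0 v x 2 = 0) (h22 : Torus.partialDeriv 2 v x 2 = 0)
    (hx : (Matrix.of fun i j : Fin 3 =>
      (Torus.partialDeriv j v x i + Torus.partialDeriv i v x j) / 2).IsHermitian) :
    hx.eigenvalues₀ (Fin.cast hd.symm 1) = 0 :=
  MiddleEigen.middle_eq_zero_of_det_eq_zero hd _ (strainMatrix_isSymm v x)
    (strainMatrix_trace_eq_zero hv hdiv x)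
    (torusStretchingDensity_eq_zero_of_patternBase hv hdiv h00 h20 h11 h02 h22).2

end Summit.NavierStokesRegularity.FunctionalMining

end
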